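import Mathlib.RingTheory.UniqueFactorizationDomain.Multiplicity
import Mathlib.NumberTheory.LSeries.Convolution
import Literature.NumberTheory.LFunctions.GaussianPrimesInSectors
import Literature.NumberTheory.LFunctions.GaussianThetaSeries
import Literature.NumberTheory.QuadraticFields.GaussianPrimary
import HarnessLib

/-!
# Von Mangoldt calculus on `ℤ[i]`: units, first-quadrant primes, and `λ^m ⋆ (Λ λ^m) = λ^m · log`

Topic `Literature/NumberTheory/LFunctions`.  Arithmetic brick of the proof of Hecke's theorem on
Gaussian primes in sectors (`Literature.NumberTheory.LFunctions.GaussianInt.hecke_gaussianPrimes_inSectors`):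
the coefficient identity behind `-D_m'(s) = D_m(s) · P_m(s)` for the Dirichlet series
`D_m(s) = ∑_{z ≠ 0} λ^m(z) N(z)^{-s}` (`GaussianHeckeThetaMellin.lean`) and the prime-power series
`P_m(s) = ∑_{π, j ≥ 1} log N(π) λ^m(π)^j N(π)^{-js}` (`π` over the Gaussian primes of Harman's first
quadrant `ℤ[i]*`, one per prime ideal).  Everything is PROVED from unique factorisation in the
Euclidean domain `ℤ[i]` (Mathlib); no named facts.

* (units of `ℤ[i]` are `±1, ±i`: `GaussianPrimary.eq_of_isUnit`, reused); `q1 z`, the associate of `z ≠ 0` in the first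
  quadrant `firstQuadrant` (`q1_mem`, `associated_q1`, uniqueness `eq_of_associated`);
* `λ^m` is a unit-invariant completely multiplicative function (`angularChar_mul`, `angularChar_pow`,
  `angularChar_unit_mul`, `angularChar_q1`);
* `primesQ1 B` (first-quadrant primes of norm `≤ B`), `pairsDiv B z = {(π, j) : π^j ∣ z}`,
  `pairsNorm n = {(π, j) : N(π)^j = n}`;
* **`∑_{π} v_π(z) log N(π) = log N(z)`** (`sum_multiplicity_mul_log`, induction on the prime
  factorisation) and **`∑_{(π,j) : π^j ∣ z} log N(π) = log N(z)`** (`sum_pairsDiv_log`);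
* the coefficients `cCoeff m n = ∑_{N(x) = n} λ^m(x)` and
  `lCoeff m n = ∑_{N(π)^j = n} log N(π) λ^m(π)^j`, and the **convolution identity**
  `(cCoeff m ⋆ lCoeff m)(n) = log n · cCoeff m n` (`convolution_cCoeff_lCoeff`), i.e.
  `λ^m ⋆ (Λ_K λ^m) = λ^m log N` summed over norms — the Dirichlet-coefficient form of
  `-D_m' = D_m P_m` (Landau, *Handbuch* §§ on `ζ_K`; Hecke 1920 §7 for `ζ(s, λ)`).

## References

* E. Hecke, *Eine neue Art von Zetafunktionen und ihre Beziehungen zur Verteilung der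
  Primzahlen. II*, Math. Z. 6 (1920), 11–51, §7. [HeckeMathZ1920]
* G. Harman, *Prime-Detecting Sieves*, LMS Monographs 33 (2007), p. 200 (`ℤ[i]*`). [Harman2007]
-/

noncomputable section

open Finset

namespace Literature.NumberTheory.LFunctions

namespace GaussianHecke

open GaussianInt GaussianTheta
-- units `±1, ±i`, `N(x) ∣ N(y)` for `x ∣ y`, `N(x^k) = N(x)^k`: reused from `GaussianPrimary.lean`
open Literature.NumberTheory.QuadraticFields.GaussianPrimary (eq_of_isUnit norm_dvd_norm norm_pow')

local notation "ℤ[i]" => _root_.GaussianInt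

open scoped Classical

/-! ### Units of `ℤ[i]` and the first-quadrant associate -/

/-- `u` is a unit of `ℤ[i]` iff `N(u) = 1`. [folklore] -/
theorem isUnit_iff_norm_eq_one {u : ℤ[i]} : IsUnit u ↔ u.norm = 1 :=
  (Zsqrtd.norm_eq_one_iff' (by norm_num) u).symm

/-- The associate of `z` in the first quadrant `{re > 0, im ≥ 0}` (Harman's `ℤ[i]*`), by explicit
rotation; `q1 0 = 0`. [cite: Harman2007, p. 200] -/
def q1 (z : ℤ[i]) : ℤ[i] :=
  if 0 < z.re ∧ 0 ≤ z.im then z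
  else if z.im < 0 ∧ 0 ≤ z.re then ⟨-z.im, z.re⟩
  else if z.re < 0 ∧ z.im ≤ 0 then ⟨-z.re, -z.im⟩
  else ⟨z.im, -z.re⟩

/-- `q1 z` lies in the first quadrant for `z ≠ 0`. [folklore] -/
theorem q1_mem {z : ℤ[i]} (hz : z ≠ 0) : q1 z ∈ firstQuadrant := by
  have hz' : ¬(z.re = 0 ∧ z.im = 0) := fun h ↦ hz (Zsqrtd.ext h.1 h.2)
  unfold q1
  split_ifs with h1 h2 h3 <;> simp only [mem_firstQuadrant] <;> omega

/-- `q1 z = u z` for a unit `u ∈ {1, i, -1, -i}`. [folklore] -/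
theorem exists_q1_eq_mul (z : ℤ[i]) : ∃ u : ℤ[i], IsUnit u ∧ q1 z = u * z := by
  unfold q1
  split_ifs
  · exact ⟨1, isUnit_one, (one_mul z).symm⟩
  · refine ⟨⟨0, 1⟩, isUnit_iff_norm_eq_one.mpr (by simp [Zsqrtd.norm_def]), Zsqrtd.ext ?_ ?_⟩ <;>
      simp
  · exact ⟨-1, isUnit_one.neg, by rw [neg_one_mul]; rfl⟩
  · refine ⟨⟨0, -1⟩, isUnit_iff_norm_eq_one.mpr (by simp [Zsqrtd.norm_def]), Zsqrtd.ext ?_ ?_⟩ <;>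
      simp

/-- `q1 z` is an associate of `z`. [folklore] -/
theorem associated_q1 (z : ℤ[i]) : Associated (q1 z) z := by
  obtain ⟨u, hu, h⟩ := exists_q1_eq_mul z
  obtain ⟨u', rfl⟩ := hu
  exact ⟨u'⁻¹, by rw [h, mul_comm, ← mul_assoc, Units.inv_mul, one_mul]⟩

/-- On the first quadrant `q1` is the identity. [folklore] -/
theorem q1_of_mem {z : ℤ[i]} (h : z ∈ firstQuadrant) : q1 z = z := by
  rw [mem_firstQuadrant] at h
  unfold q1
  rw [if_pos h]

/-- **Uniqueness**: two associated elements of the first quadrant are equal. [folklore] -/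
theorem eq_of_associated {z w : ℤ[i]} (h : Associated z w) (hz : z ∈ firstQuadrant)
    (hw : w ∈ firstQuadrant) : z = w := by
  obtain ⟨u, rfl⟩ := h
  rw [mem_firstQuadrant] at hz hw
  rcases eq_of_isUnit u.isUnit with hu | hu | hu | hu <;> rw [hu] at hw ⊢
  · rw [mul_one]
  · simp only [mul_neg, mul_one, Zsqrtd.re_neg, Zsqrtd.im_neg] at hw
    omega
  · simp only [Zsqrtd.re_mul, Zsqrtd.im_mul] at hw
    omega
  · simp only [Zsqrtd.re_mul, Zsqrtd.im_mul] at hw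
    omega

/-- Associated nonzero elements have the same first-quadrant associate. [folklore] -/
theorem q1_eq_q1 {z w : ℤ[i]} (h : Associated z w) (hz : z ≠ 0) : q1 z = q1 w :=
  eq_of_associated (((associated_q1 z).trans h).trans (associated_q1 w).symm) (q1_mem hz)
    (q1_mem (h.ne_zero_iff.mp hz))

/-- `N(q1 z) = N(z)`. [folklore] -/
theorem norm_q1 (z : ℤ[i]) : (q1 z).norm = z.norm := by
  unfold q1
  split_ifs <;> simp only [Zsqrtd.norm_def] <;> ring

/-- `q1` of a prime is prime. [folklore] -/
theorem prime_q1 {p : ℤ[i]} (hp : Prime p) : Prime (q1 p) :=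
  (associated_q1 p).symm.prime hp

/-! ### The angular characters are unit-invariant and completely multiplicative -/

/-- `λ^m(xy) = λ^m(x) λ^m(y)`. [folklore] -/
theorem angularChar_mul (m : ℕ) (x y : ℤ[i]) :
    angularChar m (x * y) = angularChar m x * angularChar m y := by
  rw [angularChar_def, angularChar_def, angularChar_def, GaussianInt.toComplex_mul, norm_mul,
    Complex.ofReal_mul, mul_div_mul_comm, mul_pow]

/-- `λ^m(1) = 1`. [folklore] -/
theorem angularChar_one' (m : ℕ) : angularChar m 1 = 1 := by
  rw [angularChar_def]
  simp

/-- `λ^m(x^j) = λ^m(x)^j`. [folklore] -/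
theorem angularChar_pow (m : ℕ) (x : ℤ[i]) (j : ℕ) :
    angularChar m (x ^ j) = angularChar m x ^ j := by
  induction j with
  | zero => rw [pow_zero, pow_zero, angularChar_one']
  | succ j ih => rw [pow_succ, pow_succ, angularChar_mul, ih]

/-- `λ^m(u) = 1` for a unit `u` (`u^4 = 1`). [folklore] -/
theorem angularChar_unit (m : ℕ) {u : ℤ[i]} (hu : IsUnit u) : angularChar m u = 1 := by
  have hI : (((⟨0, 1⟩ : ℤ[i]) : ℂ)) = Complex.I := by
    rw [GaussianInt.toComplex_def']; push_cast; ring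
  have hI' : (((⟨0, -1⟩ : ℤ[i]) : ℂ)) = -Complex.I := by
    rw [GaussianInt.toComplex_def']; push_cast; ring
  rcases eq_of_isUnit hu with rfl | rfl | rfl | rfl
  · exact angularChar_one' m
  · rw [angularChar_def, map_neg, map_one, norm_neg, norm_one, Complex.ofReal_one, div_one,
      pow_mul, show ((-1 : ℂ)) ^ 4 = 1 by norm_num, one_pow]
  · rw [angularChar_def, hI, Complex.norm_I, Complex.ofReal_one, div_one, pow_mul,
      Complex.I_pow_four, one_pow]
  · rw [angularChar_def, hI', norm_neg, Complex.norm_I, Complex.ofReal_one, div_one, pow_mul,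
      neg_pow, Complex.I_pow_four, show ((-1 : ℂ)) ^ 4 = 1 by norm_num, one_mul, one_pow]

/-- `λ^m(u z) = λ^m(z)` for a unit `u`. [folklore] -/
theorem angularChar_unit_mul (m : ℕ) {u : ℤ[i]} (hu : IsUnit u) (z : ℤ[i]) :
    angularChar m (u * z) = angularChar m z := by
  rw [angularChar_mul, angularChar_unit m hu, one_mul]

/-- `λ^m(q1 z) = λ^m(z)`. [folklore] -/
theorem angularChar_q1 (m : ℕ) (z : ℤ[i]) : angularChar m (q1 z) = angularChar m z := by
  obtain ⟨u, hu, h⟩ := exists_q1_eq_mul z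
  rw [h, angularChar_unit_mul m hu]

/-! ### Norm facts -/

/-- A Gaussian prime has norm `≥ 2`. [folklore] -/
theorem two_le_norm_of_prime {p : ℤ[i]} (hp : Prime p) : 2 ≤ p.norm := by
  have h0 : 0 < p.norm := GaussianInt.norm_pos.mpr hp.ne_zero
  have h1 : p.norm ≠ 1 := fun h ↦ hp.not_unit (isUnit_iff_norm_eq_one.mpr h)
  omega

/-- `N(z)` as a natural number: `(N z).natAbs = N z`. [folklore] -/
theorem natAbs_norm_cast (z : ℤ[i]) : ((z.norm.natAbs : ℕ) : ℤ) = z.norm :=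
  Int.natAbs_of_nonneg (GaussianInt.norm_nonneg z)

/-- The multiplicity of a prime `π` in `z ≠ 0` is less than `N(z)` (since `N(π)^{v} ≤ N(z)` and
`N(π) ≥ 2`). [folklore] -/
theorem multiplicity_lt_norm {p z : ℤ[i]} (hp : Prime p) (hz : z ≠ 0) :
    multiplicity p z < z.norm.natAbs := by
  set v := multiplicity p z
  have hfin := FiniteMultiplicity.of_prime_left hp hz
  have hdvd : p ^ v ∣ z := hfin.pow_dvd_iff_le_multiplicity.mpr le_rfl
  have hN := norm_dvd_norm hdvd
  rw [norm_pow'] at hN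
  have hzN : 0 < z.norm := GaussianInt.norm_pos.mpr hz
  have hle : p.norm ^ v ≤ z.norm := Int.le_of_dvd hzN hN
  have h2 : (2 : ℤ) ^ v ≤ p.norm ^ v := pow_le_pow_left₀ (by norm_num) (two_le_norm_of_prime hp) v
  have hv : (v : ℤ) < 2 ^ v := by exact_mod_cast Nat.lt_two_pow_self
  have := natAbs_norm_cast z
  omega

/-! ### First-quadrant primes and prime-power pairs -/

/-- The first-quadrant Gaussian primes of norm `≤ B` (one representative per prime ideal).
[folklore] -/
def primesQ1 (B : ℕ) : Finset ℤ[i] :=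
  (normLE (B : ℝ)).filter fun π ↦ Prime π ∧ π ∈ firstQuadrant

/-- Membership in `primesQ1`. [folklore] -/
theorem mem_primesQ1 {B : ℕ} {π : ℤ[i]} :
    π ∈ primesQ1 B ↔ Prime π ∧ π ∈ firstQuadrant ∧ π.norm ≤ B := by
  rw [primesQ1, mem_filter, mem_normLE]
  constructor
  · rintro ⟨h1, h2, h3⟩
    exact ⟨h2, h3, by exact_mod_cast h1⟩
  · rintro ⟨h2, h3, h1⟩
    exact ⟨by exact_mod_cast h1, h2, h3⟩

/-- The pairs `(π, j)`, `π` a first-quadrant prime of norm `≤ B`, `1 ≤ j ≤ B`, with `π^j ∣ z`.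
For `z ≠ 0` and `N(z) ≤ B` these are ALL pairs `(π, j ≥ 1)` with `π^j ∣ z` (`mem_pairsDiv_iff`).
[folklore] -/
def pairsDiv (B : ℕ) (z : ℤ[i]) : Finset (ℤ[i] × ℕ) :=
  (primesQ1 B ×ˢ Icc 1 B).filter fun p ↦ p.1 ^ p.2 ∣ z

/-- Membership in `pairsDiv`. [folklore] -/
theorem mem_pairsDiv {B : ℕ} {z : ℤ[i]} {p : ℤ[i] × ℕ} :
    p ∈ pairsDiv B z ↔ p.1 ∈ primesQ1 B ∧ p.2 ∈ Icc 1 B ∧ p.1 ^ p.2 ∣ z := by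
  rw [pairsDiv, mem_filter, mem_product, and_assoc]

/-- The pairs `(π, j)`, `π` a first-quadrant prime, `j ≥ 1`, with `N(π)^j = n`. [folklore] -/
def pairsNorm (n : ℕ) : Finset (ℤ[i] × ℕ) :=
  (primesQ1 n ×ˢ Icc 1 n).filter fun p ↦ p.1.norm.natAbs ^ p.2 = n

/-- Membership in `pairsNorm`. [folklore] -/
theorem mem_pairsNorm {n : ℕ} {p : ℤ[i] × ℕ} :
    p ∈ pairsNorm n ↔ p.1 ∈ primesQ1 n ∧ p.2 ∈ Icc 1 n ∧ p.1.norm.natAbs ^ p.2 = n := by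
  rw [pairsNorm, mem_filter, mem_product, and_assoc]

/-- For a first-quadrant prime `π` and `j ≥ 1`: `(π, j) ∈ pairsNorm (N(π)^j)` (the size bounds
`N(π) ≤ N(π)^j` and `j ≤ N(π)^j` are automatic). [folklore] -/
theorem mem_pairsNorm_of {π : ℤ[i]} (hπ : Prime π) (hq : π ∈ firstQuadrant) {j : ℕ} (hj : 1 ≤ j) :
    (π, j) ∈ pairsNorm (π.norm.natAbs ^ j) := by
  have h2 : 2 ≤ π.norm.natAbs := by
    have := two_le_norm_of_prime hπ
    have := natAbs_norm_cast π
    omega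
  have hj' : j ≤ π.norm.natAbs ^ j :=
    (Nat.lt_two_pow_self).le.trans (Nat.pow_le_pow_left h2 j)
  have hN : π.norm.natAbs ≤ π.norm.natAbs ^ j := by
    calc π.norm.natAbs = π.norm.natAbs ^ 1 := (pow_one _).symm
      _ ≤ π.norm.natAbs ^ j := Nat.pow_le_pow_right (by omega) hj
  refine mem_pairsNorm.mpr ⟨mem_primesQ1.mpr ⟨hπ, hq, ?_⟩, mem_Icc.mpr ⟨hj, hj'⟩, rfl⟩
  calc π.norm = (π.norm.natAbs : ℤ) := (natAbs_norm_cast π).symm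
    _ ≤ ((π.norm.natAbs ^ j : ℕ) : ℤ) := by exact_mod_cast hN

/-! ### `∑_π v_π(z) log N(π) = log N(z)` -/

/-- The multiplicity of the first-quadrant associate of a prime `p` in `p` is `1`. [folklore] -/
theorem multiplicity_q1_self {p : ℤ[i]} (hp : Prime p) : multiplicity (q1 p) p = 1 := by
  have hq := prime_q1 hp
  obtain ⟨v, hv⟩ := associated_q1 p
  calc multiplicity (q1 p) p = multiplicity (q1 p) (q1 p * ↑v) := by rw [hv]
    _ = multiplicity (q1 p) (q1 p) + multiplicity (q1 p) ↑v :=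
        multiplicity_mul hq (by rw [hv]; exact FiniteMultiplicity.of_prime_left hq hp.ne_zero)
    _ = 1 := by rw [multiplicity_self, multiplicity_of_unit_right hq.not_unit v]

/-- For a prime `p`: `∑_{π ∈ primesQ1 B} v_π(p) log N(π) = log N(p)` as soon as `N(p) ≤ B` (only
`π = q1 p` contributes). [folklore] -/
theorem sum_multiplicity_prime {p : ℤ[i]} (hp : Prime p) {B : ℕ} (hB : p.norm.natAbs ≤ B) :
    ∑ π ∈ primesQ1 B, (multiplicity π p : ℝ) * Real.log (π.norm : ℝ) = Real.log (p.norm : ℝ) := by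
  rw [sum_eq_single (q1 p)]
  · rw [multiplicity_q1_self hp, norm_q1, Nat.cast_one, one_mul]
  · intro π hπ hne
    obtain ⟨hπp, hπq, -⟩ := mem_primesQ1.mp hπ
    have hndvd : ¬π ∣ p := fun hdvd ↦ hne (by
      rw [← q1_of_mem hπq]
      exact q1_eq_q1 (hπp.associated_of_dvd hp hdvd) hπp.ne_zero)
    rw [multiplicity_eq_zero.mpr hndvd, Nat.cast_zero, zero_mul]
  · intro hnot
    exfalso
    refine hnot (mem_primesQ1.mpr ⟨prime_q1 hp, q1_mem hp.ne_zero, ?_⟩)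
    rw [norm_q1]
    have := natAbs_norm_cast p
    omega

/-- **`∑_{π} v_π(z) log N(π) = log N(z)`** for `z ≠ 0`, the sum over the first-quadrant primes of
norm `≤ B`, any `B ≥ N(z)` (unique factorisation in `ℤ[i]`; induction on the number of prime
factors). [folklore] -/
theorem sum_multiplicity_mul_log (z : ℤ[i]) (hz : z ≠ 0) {B : ℕ} (hB : z.norm.natAbs ≤ B) :
    ∑ π ∈ primesQ1 B, (multiplicity π z : ℝ) * Real.log (π.norm : ℝ) = Real.log (z.norm : ℝ) := by
  revert hz B
  induction z using UniqueFactorizationMonoid.induction_on_prime with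
  | h₁ => intro h; exact absurd rfl h
  | h₂ u hu =>
      intro _ B _
      have hN : u.norm = 1 := isUnit_iff_norm_eq_one.mp hu
      rw [hN, Int.cast_one, Real.log_one]
      refine sum_eq_zero fun π hπ ↦ ?_
      rw [multiplicity_of_isUnit_right (mem_primesQ1.mp hπ).1.not_unit hu, Nat.cast_zero,
        zero_mul]
  | h₃ a p ha hp ih =>
      intro _ B hB
      have hpa : p * a ≠ 0 := mul_ne_zero hp.ne_zero ha
      have hNp : 0 < p.norm := GaussianInt.norm_pos.mpr hp.ne_zero
      have hNa : 0 < a.norm := GaussianInt.norm_pos.mpr ha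
      have hcast := natAbs_norm_cast (p * a)
      have hcasta := natAbs_norm_cast a
      have hcastp := natAbs_norm_cast p
      rw [Zsqrtd.norm_mul] at hcast
      have hBa : a.norm.natAbs ≤ B := by
        have : (a.norm.natAbs : ℤ) ≤ (p * a).norm.natAbs := by
          rw [hcasta, natAbs_norm_cast, Zsqrtd.norm_mul]; nlinarith
        omega
      have hBp : p.norm.natAbs ≤ B := by
        have : (p.norm.natAbs : ℤ) ≤ (p * a).norm.natAbs := by
          rw [hcastp, natAbs_norm_cast, Zsqrtd.norm_mul]; nlinarith
        omega
      have hsplit : ∀ π ∈ primesQ1 B, (multiplicity π (p * a) : ℝ) * Real.log (π.norm : ℝ) =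
          (multiplicity π p : ℝ) * Real.log (π.norm : ℝ) +
            (multiplicity π a : ℝ) * Real.log (π.norm : ℝ) := fun π hπ ↦ by
        have hπ' := (mem_primesQ1.mp hπ).1
        rw [multiplicity_mul hπ' (FiniteMultiplicity.of_prime_left hπ' hpa)]
        push_cast
        ring
      rw [sum_congr rfl hsplit, sum_add_distrib, ih ha hBa, sum_multiplicity_prime hp hBp,
        Zsqrtd.norm_mul, Int.cast_mul, Real.log_mul]
      · exact_mod_cast hNp.ne'
      · exact_mod_cast hNa.ne'

/-- For `z ≠ 0`, `N(z) ≤ B` and a prime `π`: the exponents `j ∈ [1, B]` with `π^j ∣ z` are exactly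
`1 ≤ j ≤ v_π(z)`. [folklore] -/
theorem filter_pow_dvd_eq_Icc {π z : ℤ[i]} (hπ : Prime π) (hz : z ≠ 0) {B : ℕ}
    (hB : z.norm.natAbs ≤ B) :
    (Icc 1 B).filter (fun j ↦ π ^ j ∣ z) = Icc 1 (multiplicity π z) := by
  have hfin := FiniteMultiplicity.of_prime_left hπ hz
  have hvB : multiplicity π z ≤ B := ((multiplicity_lt_norm hπ hz).le).trans hB
  ext j
  rw [mem_filter, mem_Icc, mem_Icc, hfin.pow_dvd_iff_le_multiplicity]
  omega

/-- **`∑_{(π, j) : π^j ∣ z} log N(π) = log N(z)`** for `z ≠ 0` (pairs from `pairsDiv B z`, any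
`B ≥ N(z)`). [folklore] -/
theorem sum_pairsDiv_log (z : ℤ[i]) (hz : z ≠ 0) {B : ℕ} (hB : z.norm.natAbs ≤ B) :
    ∑ p ∈ pairsDiv B z, Real.log (p.1.norm : ℝ) = Real.log (z.norm : ℝ) := by
  rw [pairsDiv, sum_filter, sum_product, ← sum_multiplicity_mul_log z hz hB]
  refine sum_congr rfl fun π hπ ↦ ?_
  rw [← sum_filter, filter_pow_dvd_eq_Icc (mem_primesQ1.mp hπ).1 hz hB]
  simp only [sum_const, Nat.card_Icc, Nat.add_sub_cancel, nsmul_eq_mul]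

/-! ### The Dirichlet coefficients and the convolution identity -/

/-- `c_m(n) = ∑_{x ∈ ℤ[i], N(x) = n} λ^m(x)` — the `n`-th coefficient of `D_m(s) = ∑_{z ≠ 0} λ^m(z) N(z)^{-s}`
(for `n ≥ 1`). [folklore] -/
def cCoeff (m n : ℕ) : ℂ := ∑ x ∈ normEq n, angularChar m x

/-- `l_m(n) = ∑_{(π, j) : N(π)^j = n} log N(π) λ^m(π)^j` — the `n`-th coefficient of the prime-power
series `P_m(s) = -D_m'/D_m` (`π` over first-quadrant primes, `j ≥ 1`). [folklore] -/
def lCoeff (m n : ℕ) : ℂ :=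
  ∑ p ∈ pairsNorm n, (Real.log (p.1.norm : ℝ) : ℂ) * angularChar m p.1 ^ p.2

/-- The triples `(x, π, j)` with `N(x) N(π)^j = n` indexing the left side of the convolution.
[folklore] -/
def triplesL (n : ℕ) : Finset (ℤ[i] × (ℤ[i] × ℕ)) :=
  (normLE (n : ℝ) ×ˢ (primesQ1 n ×ˢ Icc 1 n)).filter
    fun t ↦ t.1.norm.natAbs * t.2.1.norm.natAbs ^ t.2.2 = n

/-- The triples `(z, π, j)` with `N(z) = n`, `π^j ∣ z` indexing the right side. [folklore] -/
def triplesR (n : ℕ) : Finset (ℤ[i] × (ℤ[i] × ℕ)) :=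
  (normEq n ×ˢ (primesQ1 n ×ˢ Icc 1 n)).filter fun t ↦ t.2.1 ^ t.2.2 ∣ t.1

/-- Membership in `triplesL`. [folklore] -/
theorem mem_triplesL {n : ℕ} {t : ℤ[i] × (ℤ[i] × ℕ)} :
    t ∈ triplesL n ↔ t.1.norm ≤ n ∧ t.2.1 ∈ primesQ1 n ∧ t.2.2 ∈ Icc 1 n ∧
      t.1.norm.natAbs * t.2.1.norm.natAbs ^ t.2.2 = n := by
  rw [triplesL, mem_filter, mem_product, mem_product, mem_normLE, and_assoc, and_assoc]
  exact ⟨fun ⟨h1, h2, h3, h4⟩ ↦ ⟨by exact_mod_cast h1, h2, h3, h4⟩,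
    fun ⟨h1, h2, h3, h4⟩ ↦ ⟨by exact_mod_cast h1, h2, h3, h4⟩⟩

/-- Membership in `triplesR`. [folklore] -/
theorem mem_triplesR {n : ℕ} {t : ℤ[i] × (ℤ[i] × ℕ)} :
    t ∈ triplesR n ↔ t.1.norm = n ∧ t.2.1 ∈ primesQ1 n ∧ t.2.2 ∈ Icc 1 n ∧ t.2.1 ^ t.2.2 ∣ t.1 := by
  rw [triplesR, mem_filter, mem_product, mem_product, mem_normEq, and_assoc, and_assoc]

/-- The left side of the convolution as a sum over `triplesL`. [folklore] -/
theorem convolution_eq_sum_triplesL (m : ℕ) {n : ℕ} (hn : n ≠ 0) :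
    LSeries.convolution (cCoeff m) (lCoeff m) n =
      ∑ t ∈ triplesL n, angularChar m t.1 *
        ((Real.log (t.2.1.norm : ℝ) : ℂ) * angularChar m t.2.1 ^ t.2.2) := by
  rw [LSeries.convolution_def]
  have hfib : ∀ de ∈ n.divisorsAntidiagonal,
      (triplesL n).filter (fun t ↦ (t.1.norm.natAbs, t.2.1.norm.natAbs ^ t.2.2) = de) =
        normEq de.1 ×ˢ pairsNorm de.2 := by
    rintro ⟨d, e⟩ hde
    obtain ⟨hmul, -⟩ := Nat.mem_divisorsAntidiagonal.mp hde
    simp only at hmul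
    have hdn : d ≤ n := Nat.le_of_dvd (Nat.pos_of_ne_zero hn) ⟨e, hmul.symm⟩
    have hen : e ≤ n := Nat.le_of_dvd (Nat.pos_of_ne_zero hn) ⟨d, by rw [mul_comm]; exact hmul.symm⟩
    ext ⟨x, π, j⟩
    simp only [mem_filter, mem_triplesL, mem_product, mem_normEq, mem_pairsNorm, Prod.mk.injEq]
    constructor
    · rintro ⟨⟨-, hπ, hj, -⟩, hxd, hπe⟩
      obtain ⟨hP, hQ, -⟩ := mem_primesQ1.mp hπ
      obtain ⟨hj1, -⟩ := mem_Icc.mp hj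
      have key := mem_pairsNorm.mp (mem_pairsNorm_of hP hQ hj1)
      rw [hπe] at key
      refine ⟨?_, key.1, key.2.1, hπe⟩
      rw [← hxd]
      exact (natAbs_norm_cast x).symm
    · rintro ⟨hxd, hπ, hj, hπe⟩
      obtain ⟨hP, hQ, hπle⟩ := mem_primesQ1.mp hπ
      obtain ⟨hj1, hje⟩ := mem_Icc.mp hj
      have hxd' : x.norm.natAbs = d := by
        have := natAbs_norm_cast x
        omega
      refine ⟨⟨?_, mem_primesQ1.mpr ⟨hP, hQ, ?_⟩, mem_Icc.mpr ⟨hj1, hje.trans hen⟩, ?_⟩, hxd', hπe⟩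
      · rw [hxd]; exact_mod_cast hdn
      · exact hπle.trans (by exact_mod_cast hen)
      · rw [hxd', hπe, hmul]
  have hmaps : ∀ t ∈ triplesL n,
      (t.1.norm.natAbs, t.2.1.norm.natAbs ^ t.2.2) ∈ n.divisorsAntidiagonal := fun t ht ↦
    Nat.mem_divisorsAntidiagonal.mpr ⟨(mem_triplesL.mp ht).2.2.2, hn⟩
  rw [← sum_fiberwise_of_maps_to hmaps]
  refine sum_congr rfl fun de hde ↦ ?_
  rw [hfib de hde, cCoeff, lCoeff, sum_mul_sum, sum_product]

/-- The right side `log n · c_m(n)` as a sum over `triplesR` (via `sum_pairsDiv_log`). [folklore] -/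
theorem logMul_eq_sum_triplesR (m : ℕ) {n : ℕ} (hn : n ≠ 0) :
    (Real.log n : ℂ) * cCoeff m n =
      ∑ t ∈ triplesR n, angularChar m t.1 * (Real.log (t.2.1.norm : ℝ) : ℂ) := by
  rw [cCoeff, mul_sum, triplesR, sum_filter, sum_product]
  refine sum_congr rfl fun z hz ↦ ?_
  rw [mem_normEq] at hz
  have hz0 : z ≠ 0 := by
    rw [← GaussianInt.norm_eq_zero.ne, hz]; exact_mod_cast hn
  have hB : z.norm.natAbs ≤ n := by rw [hz, Int.natAbs_natCast]
  rw [← sum_filter, show (primesQ1 n ×ˢ Icc 1 n).filter (fun q : ℤ[i] × ℕ ↦ q.1 ^ q.2 ∣ z) =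
      pairsDiv n z from rfl]
  dsimp only
  rw [← mul_sum, mul_comm]
  congr 1
  rw [← Complex.ofReal_sum, sum_pairsDiv_log z hz0 hB, hz, Int.cast_natCast]

/-- **The convolution identity `λ^m ⋆ (Λ λ^m) = λ^m · log N`** on the level of norms:
`(c_m ⋆ l_m)(n) = log n · c_m(n)` for every `n`, where `⋆` is Dirichlet convolution
(`LSeries.convolution`). This is the coefficient form of `-D_m'(s) = D_m(s) P_m(s)`.
[cite: HeckeMathZ1920, §7] -/
theorem convolution_cCoeff_lCoeff (m n : ℕ) :
    LSeries.convolution (cCoeff m) (lCoeff m) n = (Real.log n : ℂ) * cCoeff m n := by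
  rcases eq_or_ne n 0 with rfl | hn
  · simp
  rw [convolution_eq_sum_triplesL m hn, logMul_eq_sum_triplesR m hn]
  -- bijection `(x, π, j) ↦ (x π^j, π, j)` with inverse `(z, π, j) ↦ (z / π^j, π, j)`
  refine sum_nbij' (fun t ↦ (t.1 * t.2.1 ^ t.2.2, t.2)) (fun t ↦ (t.1 / t.2.1 ^ t.2.2, t.2))
    ?_ ?_ ?_ ?_ ?_
  · rintro ⟨x, π, j⟩ ht
    obtain ⟨hx, hπ, hj, hprod⟩ := mem_triplesL.mp ht
    refine mem_triplesR.mpr ⟨?_, hπ, hj, dvd_mul_left _ _⟩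
    show (x * π ^ j).norm = n
    rw [Zsqrtd.norm_mul, norm_pow', ← natAbs_norm_cast x, ← natAbs_norm_cast π]
    exact_mod_cast hprod
  · rintro ⟨z, π, j⟩ ht
    obtain ⟨hz, hπ, hj, hdvd⟩ := mem_triplesR.mp ht
    have hπ0 : π ^ j ≠ 0 := pow_ne_zero _ (mem_primesQ1.mp hπ).1.ne_zero
    have hzx : π ^ j * (z / π ^ j) = z := EuclideanDomain.mul_div_cancel' hπ0 hdvd
    have hnorm : (π ^ j).norm * (z / π ^ j).norm = n := by rw [← Zsqrtd.norm_mul, hzx, hz]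
    have hNq : 0 < (π ^ j).norm := GaussianInt.norm_pos.mpr hπ0
    have hNx : 0 ≤ (z / π ^ j).norm := GaussianInt.norm_nonneg _
    refine mem_triplesL.mpr ⟨?_, hπ, hj, ?_⟩
    · show (z / π ^ j).norm ≤ n
      nlinarith
    · show (z / π ^ j).norm.natAbs * π.norm.natAbs ^ j = n
      have h1 := natAbs_norm_cast (z / π ^ j)
      have h2 := natAbs_norm_cast π
      have : (((z / π ^ j).norm.natAbs * π.norm.natAbs ^ j : ℕ) : ℤ) = n := by
        rw [Nat.cast_mul, Nat.cast_pow, h1, h2, ← norm_pow', mul_comm, hnorm]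
      exact_mod_cast this
  · rintro ⟨x, π, j⟩ ht
    have hπ0 : π ^ j ≠ 0 := pow_ne_zero _ (mem_primesQ1.mp (mem_triplesL.mp ht).2.1).1.ne_zero
    simp only [Prod.mk.injEq, and_true]
    exact mul_div_cancel_right₀ x hπ0
  · rintro ⟨z, π, j⟩ ht
    obtain ⟨-, hπ, -, hdvd⟩ := mem_triplesR.mp ht
    have hπ0 : π ^ j ≠ 0 := pow_ne_zero _ (mem_primesQ1.mp hπ).1.ne_zero
    simp only [Prod.mk.injEq, and_true]
    rw [mul_comm]
    exact EuclideanDomain.mul_div_cancel' hπ0 hdvd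
  · rintro ⟨x, π, j⟩ _
    simp only
    rw [angularChar_mul, angularChar_pow]
    ring

end GaussianHecke

end Literature.NumberTheory.LFunctions
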